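import Mathlib
import HarnessLib
import Summits.Langlands.Statement
import Summits.Langlands.Langlands.Theses.SkinnerWilesDefectOne
import Summits.Langlands.Langlands.Theses.SymmetryTypeSplit
import Literature.NumberTheory.Automorphic.CaraianiNewtonModularity
import Summits.Langlands.Langlands.Theses.EllipticTraceSplit
set_option linter.dupNamespace false
set_option linter.unusedVariables false
set_option linter.unusedSectionVars false

/-!
# Birth skeleton (BC3) for crux `EllipticTraceSplit.EllipticGenericProModular` — line `birth` (AFTER-BIRTH form: the route decl BY NAME)

Node `EllipticTraceSplit` (decomp-langlands lens-2 g19; child route refining `SymmetryTypeSplit:GenericProModular` stmt-Langlands-27289).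
Shape: stubs `theorem stub_<name> : <signature> := by sorry` (each a genuine piece — no stub restates the cell, GEN, E or the summit: probes
`probes_stubs_EllipticGenericProModular.lean`), `namespace _Goal` naming each stub statement, and the kernel-checked composition
`EllipticGenericProModular_of (h₁ : _Goal.stub_…) … : <the crux BY NAME>`.  `lean check --json`: rc 0, sorries = the stubs (3), none elsewhere.
-/

namespace Summit.Langlands.Langlands.Cruxes.EllipticGenericProModular.Birth

open scoped NumberField
open Filter IsDedekindDomain Literature.NumberTheory.GaloisRepresentations Literature.NumberTheory.Automorphic

/-- stub · `stub_caraianiNewton2023` — PRINT, by NAME: the tree's named fact `Literature.NumberTheory.Automorphic.CaraianiNewton2023_modularity` (Caraiani–Newton 2023, Thm 1.1 = Cor 7.1.2: every elliptic curve over an imaginary quadratic F with X₀(15)(F) finite is modular).  Size: accepted named fact (closes when the Literature debt is paid / taken as hypothesis). -/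
theorem stub_caraianiNewton2023 :
    Literature.NumberTheory.Automorphic.CaraianiNewton2023_modularity := by
  sorry

/-- stub · `stub_ellipticDictionary` — JUNCTION 1 (instrument I-g19.1): a weight-zero cuspidal π on GL₂(𝔸_F) with T_w-eigenvalues a_w(E) a.e. (the automorphic alternative of `IsModularEllipticCurve F E`, verbatim) makes every framed ρ : Γ_F → GL₂(ℚ̄_p) with charpoly ρ(Frob_w) = X² − a_w(E)X + q_w a.e. (so ρ ≅ V_p E) a continuous ℚ̄_p-point of 𝕋(U^p) for some tame level [GeeNewton2020 §2.1; Franke 1998; Harder 1987 (Eichler–Shimura for Bianchi groups)].  Size: M (dictionary; vocabulary in tree). -/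
theorem stub_ellipticDictionary :
    ∀ (F : Type) [Field F] [NumberField F], NumberField.IsTotallyComplex F → Module.finrank ℚ F = 2 → ∀ (p : ℕ) [Fact p.Prime], p ≠ 2 → ∀ (ρ : Literature.NumberTheory.GaloisRepresentations.FramedGaloisRep F (PadicAlgCl p) 2) (E : WeierstrassCurve (NumberField.RingOfIntegers F)), E.Δ ≠ 0 → (∀ᶠ w : IsDedekindDomain.HeightOneSpectrum (NumberField.RingOfIntegers F) in Filter.cofinite, ρ.HasFrobCharpolyAt w (Polynomial.X ^ 2 - Polynomial.C ((Literature.NumberTheory.Automorphic.frobTraceAt E w : ℤ) : PadicAlgCl p) * Polynomial.X + Polynomial.C ((w.residueCard : ℕ) : PadicAlgCl p))) → (∃ (hF : Literature.NumberTheory.Automorphic.isCompact_glFiniteIntegralLevel 2 F) (π : Literature.NumberTheory.Automorphic.CuspidalAutomorphicRepData 2 F hF), π.1.HasWeightZero ∧ ∀ᶠ w : IsDedekindDomain.HeightOneSpectrum (NumberField.RingOfIntegers F) in Filter.cofinite, ∃ α : Multiset ℂ, π.1.HasSatakeParamAt w α ∧ ((Real.sqrt w.residueCard : ℝ) : ℂ)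 * α.sum = (Literature.NumberTheory.Automorphic.frobTraceAt E w : ℂ)) → ∃ 𝒰 : Literature.NumberTheory.Automorphic.BigHeckeGLn.TameLevel 2 F p, 𝒰.IsPadicallyAutomorphic ρ := by
  sorry

/-- stub · `stub_twistTransport` — JUNCTION 2 (instrument I-g19.2): p-adic automorphy of some tame level is stable under twisting by a continuous character ν : Γ_F → ℚ̄_pˣ of FINITE order (T_w ↦ ν(Frob_w)·T_w on completed cohomology of a tame level small enough for ν ∘ Art) [GeeNewton2020 §2.1.1; standard].  Size: S/M (tree lemma once `TameLevel` shrinking is available). -/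
theorem stub_twistTransport :
    ∀ (F : Type) [Field F] [NumberField F], NumberField.IsTotallyComplex F → Module.finrank ℚ F = 2 → ∀ (p : ℕ) [Fact p.Prime], p ≠ 2 → ∀ (ρ ρ₁ : Literature.NumberTheory.GaloisRepresentations.FramedGaloisRep F (PadicAlgCl p) 2) (ν : Field.absoluteGaloisGroup F →ₜ* (PadicAlgCl p)ˣ), (∃ n : ℕ, 0 < n ∧ ∀ σ, ν σ ^ n = 1) → (∀ σ : Field.absoluteGaloisGroup F, (ρ σ).val = ((ν σ : (PadicAlgCl p)ˣ) : PadicAlgCl p) • (ρ₁ σ).val) → (∃ 𝒰 : Literature.NumberTheory.Automorphic.BigHeckeGLn.TameLevel 2 F p, 𝒰.IsPadicallyAutomorphic ρ₁) → ∃ 𝒰 : Literature.NumberTheory.Automorphic.BigHeckeGLn.TameLevel 2 F p, 𝒰.IsPadicallyAutomorphic ρ := by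
  sorry

namespace _Goal

/-- the statement of `stub_caraianiNewton2023` as a named Prop. -/
def stub_caraianiNewton2023 : Prop :=
  type_of% @Summit.Langlands.Langlands.Cruxes.EllipticGenericProModular.Birth.stub_caraianiNewton2023

/-- the statement of `stub_ellipticDictionary` as a named Prop. -/
def stub_ellipticDictionary : Prop :=
  type_of% @Summit.Langlands.Langlands.Cruxes.EllipticGenericProModular.Birth.stub_ellipticDictionary

/-- the statement of `stub_twistTransport` as a named Prop. -/
def stub_twistTransport : Prop :=
  type_of% @Summit.Langlands.Langlands.Cruxes.EllipticGenericProModular.Birth.stub_twistTransport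

end _Goal

/-- **`EllipticGenericProModular` from the 3 stubs** (kernel-checked, no sorry). -/
theorem EllipticGenericProModular_of (h1 : _Goal.stub_caraianiNewton2023) (h2 : _Goal.stub_ellipticDictionary) (h3 : _Goal.stub_twistTransport) :
    Summit.Langlands.Langlands.Theses.EllipticTraceSplit.EllipticGenericProModular := by
  have ha : type_of% @stub_caraianiNewton2023 := h1
  have hb2 : type_of% @stub_ellipticDictionary := h2
  have hc3 : type_of% @stub_twistTransport := h3
  intro F _ _ hF hd p _ hp O hO ρ ρ₀ hirr hunr hint hord hns hno hb
  obtain ⟨hfin, E, ν, ρ₁, hΔ, hncm, hν, hE, htw⟩ := hb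
  rcases ha F hF hd hfin E hΔ with hcm | hπ
  · exact absurd hcm hncm
  · exact hc3 F hF hd p hp ρ ρ₁ ν hν htw (hb2 F hF hd p hp ρ₁ E hΔ hE hπ)

/-- by-name sanity (an `example`): the stubs feed the composition as they stand. -/
example : Summit.Langlands.Langlands.Theses.EllipticTraceSplit.EllipticGenericProModular :=
  EllipticGenericProModular_of stub_caraianiNewton2023 stub_ellipticDictionary stub_twistTransport

/-- hypothesis-free assembly (inherits the stubs' `sorry`, nothing else). -/
theorem EllipticGenericProModular_proof : Summit.Langlands.Langlands.Theses.EllipticTraceSplit.EllipticGenericProModular :=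
  EllipticGenericProModular_of stub_caraianiNewton2023 stub_ellipticDictionary stub_twistTransport

end Summit.Langlands.Langlands.Cruxes.EllipticGenericProModular.Birth
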